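import Summits.HodgeConjecture.HodgeConjecture.Theorems.DworkReflectionQuotientsGIPreliminaries

/-!
# Route `DworkReflectionQuotients`: crux `GenericInvariantHodgeClasses` (GI) from the two analytic inputs
# of the Noether–Lefschetz argument along the Dwork pencil

Route `route-HodgeConjecture-DworkReflectionQuotients` (cell `hodge-nonav`; FRONTIER rung F-H1 — never summit
credit), item `stmt-HodgeConjecture-24129` `GenericInvariantHodgeClasses` (crux, filed 2026-08-28 by the
tenure planner from the reduction `leaf ⟸ K1 + DworkOtherCodimensions + GI` of
`Theorems/DworkReflectionQuotientsHodgeOfInvariantPart`). Prover seat `hodge-nonav-20241-p1` (g9).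
SUPPORT FILE (`--supports`): the item's decl is not yet in the route file, so the main theorem concludes the
item's SIGNATURE VERBATIM; it takes the two analytic inputs as HYPOTHESES (published analytic results
specialised to the Dwork pencil, in the tree's vocabulary).

THE ARGUMENT (Voisin II §5.3, Thm. 6.24, run on a CURVE). Let `π : 𝒳 → D`, `D = 𝔸¹ ∖ μ₆`, be the Dwork
pencil (`DworkSextic.pencil`, file `Literature/…/DworkSexticPencilFamily`, fibre over `[F_ψ]` ≅ `X_ψ`
compatibly with `ℙ⁵`). The `Γ_W`-invariant part of `H⁴(X_ψ)` is `ℚh² ⊕ H[0]`, `H[0]` of rank `5` with Hodge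
numbers `(1,1,1,1,1)` (Katz 2009 §3). A flat section `ξ` of `R⁴π_*ℂ` near `t`, invariant and of type
`(2,2)` at `t`: (hol) the set of nearby `t'` with `ξ_{t'} ∈ F²` is analytic, so on the curve `D(ℂ)` it is
a neighbourhood of `t` or `t` is ISOLATED in it; (climb) if it is a neighbourhood, `∇ξ = 0` forces
`∇̄(ξ_t mod F³) = 0`, and `∇̄_{∂/∂ψ}` on `Gr²_F = ℂh² ⊕ R₁₂(F_ψ)^{Γ_W}` is multiplication by
`∂F_ψ/∂ψ = −6∏xᵢ` (Carlson–Griffiths, Voisin II Thm. 6.13), INJECTIVE on the invariant line at every `ψ`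
by the tree theorems `DworkSextic.prod_X_mul_mem_jacobianIdeal_iff`, `monomial_sub_C_mul_prod_X_pow_mem_jacobianIdeal`
(files `DworkSexticJacobianInvariantLine{,Injective}`), so `ξ_t ∈ F³ + ℂh²`; a `(2,2)`-class in `F³ + ℂh²`
is a multiple of `h²`, hence algebraic. So every non-algebraic invariant rational `(2,2)`-class sits at an
isolated point of the locus of ONE of countably many tube classes over ONE of countably many Ehresmann balls:
countably many parameters.

* preliminaries (file `DworkReflectionQuotientsGIPreliminaries`): isolated points of a subset of a
  second-countable space are countable; rational classes of a smooth projective variety are countable; a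
  `(p,q)`-class in `Fʳ`, `r > p`, vanishes; transfer of `Γ_W`-invariance from `X_ψ` to the fibre `𝒳_{[F_ψ]}`;
* this file: the main theorem `genericInvariantHodgeClasses_of_hol_of_climb : hol → climb → <signature of
  stmt-24129>` with the two analytic inputs as EXPLICIT HYPOTHESES (their typing as cite-tagged Literature
  facts `Voisin2002_dworkPencil_hodgeFiltrationTwo_locus_dichotomy` / `Voisin2003_dworkPencil_invariantFlatSection_climb`
  is the companion `Literature/AlgebraicGeometry/HodgeTheory/DworkSexticPencilHodgeLoci`).

Honest framing: a CONDITIONAL theorem (two analytic hypotheses: holomorphy of `F²𝓗⁴` along the pencil,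
Griffiths–Carlson–Voisin IVHS on the invariant piece); nothing here says HC, HC_CM or HC_AV is proved; rung
F-H1 not moved.

## References

* C. Voisin, *Hodge Theory and Complex Algebraic Geometry II* (2003), §5.3.1 Lemma 5.13, §5.3.2 Cor. 5.17,
  §6.1.2 Cor. 6.12, §6.1.3 Thm. 6.13, §6.3.1 Thm. 6.24 (proof). [VoisinHodgeII2003]
* C. Voisin, *Hodge Theory and Complex Algebraic Geometry I* (2002), Thm. 9.3, §9.2.1, §10.2 Thm. 10.3.
  [VoisinHodgeI2002]
* J. Carlson, P. Griffiths, Infinitesimal variations of Hodge structure and the global Torelli problem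
  (1980), §3. [CarlsonGriffiths1980IVHS]
* N. M. Katz, *Another look at the Dwork family*, Progr. Math. 270 (2009), §3. [Katz2009]
-/

namespace Summit.HodgeConjecture.HodgeConjecture.Theorems

open CategoryTheory AlgebraicGeometry
open _root_.Topology _root_.Filter
open Literature.AlgebraicGeometry.HodgeTheory Literature.AlgebraicGeometry.Motives
open Literature.AlgebraicGeometry.Motives.UniversalHypersurface
open Literature.AlgebraicGeometry.HodgeTheory.UniversalHypersurface
open Literature.AlgebraicTopology.SingularHomology
open scoped BigOperators
/-! ### `GenericInvariantHodgeClasses` from the two analytic inputs -/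

/-- **Crux `GenericInvariantHodgeClasses` (stmt-HodgeConjecture-24129) of route `DworkReflectionQuotients`
from the two analytic inputs of the Noether–Lefschetz argument along the Dwork pencil.**

Setting: `π = DworkSextic.pencil : 𝒳 → D`, `D = 𝔸¹ ∖ μ₆` (file `DworkSexticPencilFamily`), tube classes
`ξ ∈ H⁴(π⁻¹B(ℂ); ℂ)` over open `B ⊆ D(ℂ)` and their restrictions `ξ|_{𝒳_t}` (`fiberRestrict`; over small
`B` these are the flat sections of `R⁴π_*ℂ`, Voisin I §9.2.1), the Hodge filtration `F^r H⁴(𝒳_t)`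
(`IsInHodgeFiltration`).

HYPOTHESES (the two printed analytic inputs, NOT proved in the tree):
* `hhol` — **holomorphy of `F²𝓗⁴` read on the curve `D(ℂ)`** (Voisin I Thm. 10.3 / II Lemma 5.13 +
  the identity theorem): if the set of `t' ∈ B` at which `ξ|_{𝒳_{t'}} ∈ F²` accumulates at `t`, it is a
  neighbourhood of `t`;
* `hclimb` — **the infinitesimal Noether–Lefschetz step on the `Γ_W`-invariant part** (Voisin II
  Cor. 6.12 + Thm. 6.13 for the pencil, combined with the tree theorems
  `DworkSextic.prod_X_mul_mem_jacobianIdeal_iff` / `monomial_sub_C_mul_prod_X_pow_mem_jacobianIdeal`: on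
  the invariant line of the Jacobian ring multiplication by `∂F_ψ/∂ψ = −6∏xᵢ` is injective
  `R₁₂ → R₁₈` at EVERY `ψ`): if `ξ|_{𝒳_t}` is invariant under every continuous self-map of `𝒳_t(ℂ)`
  realising a diagonal symmetry `a ∈ μ₆⁶`, `∏ aᵢ = 1`, in the coordinates of `𝒳_t → ℙ⁵`, and
  `ξ|_{𝒳_{t'}} ∈ F²` for all `t'` near `t`, then `ξ|_{𝒳_t} ∈ F³ + j_t^* H⁴(ℙ⁵(ℂ); ℂ)`.

CONCLUSION: the signature of the item verbatim — off a countable set of `ψ`, every `Γ_W`-invariant rational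
`(2,2)`-class on `X_ψ` is algebraic. PROOF (Voisin II §5.3.1–5.3.2 on a curve): the bad parameters
inject (`DworkSextic.pencilPoint_injective`) into the set `T ⊆ D(ℂ)` of points carrying a bad class;
cover `D(ℂ)` by countably many Ehresmann balls `B` (`DworkSextic.isHomotopicallyLocallyTrivialOn_pencil`,
Lindelöf); a bad class `x` at `t ∈ B` is the restriction of a unique tube class `ξ`, rational at the centre
of `B` (homotopy invariance), so `ξ` ranges in a countable set; `t` lies in
`L_ξ = {t' ∈ B : ξ|_{t'} ∈ F²}` and is ISOLATED there — otherwise `hhol` and `hclimb` give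
`x − j_t^*θ ∈ F³` with `x − j_t^*θ` of type `(2,2)` (`j_t^*θ` is algebraic, `range_map_projectiveSpace_le_algebraicClasses`),
hence `x = j_t^*θ` algebraic; isolated points of any subset of the second-countable `D(ℂ)` are countable.
The passage `X_ψ ↔ 𝒳_{[F_ψ]}` is along the fibre isomorphisms compatible with `ℙ⁵`
(`DworkSextic.exists_fiberIso_pencilPoint`; rationality, Hodge type, algebraicity and invariance transport).
Conditional theorem; nothing here says HC, HC_CM or HC_AV is proved; rung F-H1 not moved.
[cite: VoisinHodgeII2003, §5.3.1 Lemma 5.13 and §5.3.2 Cor. 5.17, Thm. 6.13, Thm. 6.24 (proof)]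
[cite: VoisinHodgeI2002, Thm. 9.3, §9.2.1, Thm. 10.3] [cite: Katz2009, §3] -/
theorem genericInvariantHodgeClasses_of_hol_of_climb
    (hhol : ∀ (B : Set (ComplexPoints (baseSpz ℂ 4 6 DworkSextic.pencilSpz))), IsOpen B →
      ∀ (ξ : singularCohomology ℂ ℂ (tubeOver DworkSextic.pencil B) (2 * 2))
        (t : ComplexPoints (baseSpz ℂ 4 6 DworkSextic.pencilSpz)) (_ : t ∈ B),
        (∃ᶠ t' in 𝓝[≠] t, ∃ ht' : t' ∈ B,
            IsInHodgeFiltration 4 (fiberOver DworkSextic.pencil t') (2 * 2) 2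
              (fiberRestrict DworkSextic.pencil ht' (2 * 2) ξ)) →
        ∀ᶠ t' in 𝓝 t, ∃ ht' : t' ∈ B,
            IsInHodgeFiltration 4 (fiberOver DworkSextic.pencil t') (2 * 2) 2
              (fiberRestrict DworkSextic.pencil ht' (2 * 2) ξ))
    (hclimb : ∀ (B : Set (ComplexPoints (baseSpz ℂ 4 6 DworkSextic.pencilSpz))), IsOpen B →
      ∀ (ξ : singularCohomology ℂ ℂ (tubeOver DworkSextic.pencil B) (2 * 2))
        (t : ComplexPoints (baseSpz ℂ 4 6 DworkSextic.pencilSpz)) (ht : t ∈ B),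
        (∀ a : Fin 6 → ℂ, (∀ i, a i ^ 6 = 1) → ∏ i, a i = 1 →
          ∀ g : C(ComplexPoints (fiberOver DworkSextic.pencil t), ComplexPoints (fiberOver DworkSextic.pencil t)),
            (∀ y, ∃ s : ℂ, (hypersurfacePoint (DworkSextic.pencilFiberToProjectiveSpace t) (g y)).rep =
                s • (a * (hypersurfacePoint (DworkSextic.pencilFiberToProjectiveSpace t) y).rep)) →
            singularCohomology.map ℂ ℂ g (2 * 2) (fiberRestrict DworkSextic.pencil ht (2 * 2) ξ) =
              fiberRestrict DworkSextic.pencil ht (2 * 2) ξ) →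
        (∀ᶠ t' in 𝓝 t, ∃ ht' : t' ∈ B,
            IsInHodgeFiltration 4 (fiberOver DworkSextic.pencil t') (2 * 2) 2
              (fiberRestrict DworkSextic.pencil ht' (2 * 2) ξ)) →
        ∃ θ : complexBetti (Literature.AlgebraicGeometry.Motives.projectiveSpace (4 + 1) ℂ) (2 * 2),
          IsInHodgeFiltration 4 (fiberOver DworkSextic.pencil t) (2 * 2) 3
            (fiberRestrict DworkSextic.pencil ht (2 * 2) ξ -
              complexBetti.map (DworkSextic.pencilFiberToProjectiveSpace t) (2 * 2) θ)) :
    ∃ S : Set ℂ, S.Countable ∧ ∀ ψ : ℂ, ψ ∉ S → ψ ^ 6 ≠ 1 → let F : MvPolynomial (Fin 6) ℂ := (∑ i, MvPolynomial.X i ^ 6) - MvPolynomial.C (6 * ψ) * ∏ i, MvPolynomial.X i; let X := Literature.AlgebraicGeometry.Motives.SmoothHypersurface.hypersurface F; let pt := Literature.AlgebraicGeometry.HodgeTheory.hypersurfacePoint (Literature.AlgebraicGeometry.Motives.SmoothHypersurface.hypersurfaceι F); ∀ c : Literature.AlgebraicGeometry.HodgeTheory.complexBetti X (2 * 2), Literature.AlgebraicGeometry.HodgeTheory.IsRationalClass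 c → Literature.AlgebraicGeometry.HodgeTheory.IsOfHodgeType 4 X (2 * 2) 2 2 c → (∀ a : Fin 6 → ℂ, (∀ i, a i ^ 6 = 1) → ∏ i, a i = 1 → ∀ g : C(Literature.AlgebraicGeometry.Motives.ComplexPoints X, Literature.AlgebraicGeometry.Motives.ComplexPoints X), (∀ x, ∃ t : ℂ, (pt (g x)).rep = t • (a * (pt x).rep)) → Literature.AlgebraicTopology.SingularHomology.singularCohomology.map ℂ ℂ g (2 * 2) c = c) → c ∈ Literature.AlgebraicGeometry.HodgeTheory.algebraicClasses X 2 := by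
  classical
  -- the family and its fibres
  have hfam := DworkSextic.isSmoothProjectiveFamily_pencil
  have hYsp : ∀ t : ComplexPoints (baseSpz ℂ 4 6 DworkSextic.pencilSpz),
      IsSmoothProjective 4 (fiberOver DworkSextic.pencil t) := hfam.isSmoothProjective
  -- Ehresmann balls around every point
  have hE := DworkSextic.isHomotopicallyLocallyTrivialOn_pencil
  choose B hBo htB _ _ hBe using
    fun t : ComplexPoints (baseSpz ℂ 4 6 DworkSextic.pencilSpz) =>
      hE.exists_nhds_homotopyEquiv (Set.mem_univ t) Set.univ Filter.univ_mem
  -- `D(ℂ)` is second countable (finite type over `ℂ`): a countable subcover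
  haveI : LocallyOfFiniteType (baseSpz ℂ 4 6 DworkSextic.pencilSpz).hom :=
    locallyOfFiniteType_baseSpz_hom ℂ 4 6 _
  haveI : CompactSpace (baseSpz ℂ 4 6 DworkSextic.pencilSpz).left := DworkSextic.compactSpace_baseSpz_left _
  haveI : SecondCountableTopology (ComplexPoints (baseSpz ℂ 4 6 DworkSextic.pencilSpz)) :=
    ComplexPoints.secondCountableTopology_of_compactSpace_holds _
  obtain ⟨T0, hT0c, hT0⟩ := TopologicalSpace.isOpen_iUnion_countable B hBo
  have hcover : ∀ t, ∃ t0 ∈ T0, t ∈ B t0 := by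
    intro t
    have h : t ∈ ⋃ i, B i := Set.mem_iUnion.mpr ⟨t, htB t⟩
    rw [← hT0] at h
    simpa only [Set.mem_iUnion, exists_prop] using h
  -- every point of a ball is a specialising centre
  have hSp : ∀ t0 {s} (hs : s ∈ B t0), IsSpecialisingNhd DworkSextic.pencil s (2 * 2) (B t0) := by
    intro t0 s hs
    obtain ⟨e, he⟩ := hBe t0 hs
    exact IsSpecialisingNhd.of_homotopyEquiv (hBo t0) hs e he (2 * 2)
  -- the bad points of `D(ℂ)`
  set Bad : Set (ComplexPoints (baseSpz ℂ 4 6 DworkSextic.pencilSpz)) :=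
    {t | ∃ x : complexBetti (fiberOver DworkSextic.pencil t) (2 * 2),
      IsRationalClass x ∧ IsOfHodgeType 4 (fiberOver DworkSextic.pencil t) (2 * 2) 2 2 x ∧
      (∀ a : Fin 6 → ℂ, (∀ i, a i ^ 6 = 1) → ∏ i, a i = 1 →
        ∀ g : C(ComplexPoints (fiberOver DworkSextic.pencil t), ComplexPoints (fiberOver DworkSextic.pencil t)),
          (∀ y, ∃ s : ℂ, (hypersurfacePoint (DworkSextic.pencilFiberToProjectiveSpace t) (g y)).rep =
              s • (a * (hypersurfacePoint (DworkSextic.pencilFiberToProjectiveSpace t) y).rep)) →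
          singularCohomology.map ℂ ℂ g (2 * 2) x = x) ∧
      x ∉ algebraicClasses (fiberOver DworkSextic.pencil t) 2} with hBad
  -- the loci `L_ξ` and the countable index sets `Ξ t0`
  set L : ∀ t0 : ComplexPoints (baseSpz ℂ 4 6 DworkSextic.pencilSpz),
      singularCohomology ℂ ℂ (tubeOver DworkSextic.pencil (B t0)) (2 * 2) →
        Set (ComplexPoints (baseSpz ℂ 4 6 DworkSextic.pencilSpz)) :=
    fun t0 ξ => {t' | ∃ ht' : t' ∈ B t0, IsInHodgeFiltration 4 (fiberOver DworkSextic.pencil t') (2 * 2) 2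
      (fiberRestrict DworkSextic.pencil ht' (2 * 2) ξ)} with hL
  set Ξ : ∀ t0 : ComplexPoints (baseSpz ℂ 4 6 DworkSextic.pencilSpz),
      Set (singularCohomology ℂ ℂ (tubeOver DworkSextic.pencil (B t0)) (2 * 2)) :=
    fun t0 => {ξ | IsRationalClass (fiberRestrict DworkSextic.pencil (htB t0) (2 * 2) ξ)} with hΞ
  have hΞc : ∀ t0, (Ξ t0).Countable := fun t0 => by
    have hinj : Set.InjOn (fun ξ => fiberRestrict DworkSextic.pencil (htB t0) (2 * 2) ξ) (Ξ t0) :=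
      fun ξ _ ξ' _ h => (hSp t0 (htB t0)).bijective.1 h
    exact Set.MapsTo.countable_of_injOn
      (t := {x : complexBetti (fiberOver DworkSextic.pencil t0) (2 * 2) | IsRationalClass x})
      (fun ξ hξ => hξ) hinj (countable_setOf_isRationalClass_complexPoints (hYsp t0) (2 * 2))
  -- the key inclusion: a bad point is an isolated point of some `L_ξ`, `ξ ∈ Ξ t0`, `t0 ∈ T0`
  have hBad_sub : Bad ⊆ ⋃ t0 ∈ T0, ⋃ ξ ∈ Ξ t0, {t | t ∈ L t0 ξ ∧ ¬ ∃ᶠ t' in 𝓝[≠] t, t' ∈ L t0 ξ} := by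
    intro t ht
    obtain ⟨x, hxrat, hxH, hxinv, hxnot⟩ := ht
    obtain ⟨t0, ht0T, htB0⟩ := hcover t
    set ξ := (hSp t0 htB0).restrictEquiv.symm x with hξdef
    have hξ' : fiberRestrict DworkSextic.pencil htB0 (2 * 2) ξ = x :=
      (hSp t0 htB0).fiberRestrict_restrictEquiv_symm x
    refine Set.mem_iUnion₂.mpr ⟨t0, ht0T, Set.mem_iUnion₂.mpr ⟨ξ, ?_, ?_, ?_⟩⟩
    · -- `ξ` is rational on the tube, hence at the centre
      obtain ⟨e, he⟩ := hBe t0 htB0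
      have hξrat : IsRationalClass ξ :=
        isRationalClass_of_homotopyEquiv DworkSextic.pencil htB0 e he ξ (by rw [hξ']; exact hxrat)
      exact hξrat.map (fiberToTube DworkSextic.pencil (htB t0))
    · exact ⟨htB0, by rw [hξ']; exact IsInHodgeFiltration.of_isOfHodgeType_pp hxH⟩
    · intro hfreq
      apply hxnot
      have hev := hhol (B t0) (hBo t0) ξ t htB0 (hfreq.mono fun t' ht' => ht')
      have hinv' : ∀ a : Fin 6 → ℂ, (∀ i, a i ^ 6 = 1) → ∏ i, a i = 1 →
          ∀ g : C(ComplexPoints (fiberOver DworkSextic.pencil t), ComplexPoints (fiberOver DworkSextic.pencil t)),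
            (∀ y, ∃ s : ℂ, (hypersurfacePoint (DworkSextic.pencilFiberToProjectiveSpace t) (g y)).rep =
                s • (a * (hypersurfacePoint (DworkSextic.pencilFiberToProjectiveSpace t) y).rep)) →
            singularCohomology.map ℂ ℂ g (2 * 2) (fiberRestrict DworkSextic.pencil htB0 (2 * 2) ξ) =
              fiberRestrict DworkSextic.pencil htB0 (2 * 2) ξ := by
        rw [hξ']
        exact hxinv
      obtain ⟨θ, hθ⟩ := hclimb (B t0) (hBo t0) ξ t htB0 hinv' hev
      rw [hξ'] at hθ
      have hθalg : complexBetti.map (DworkSextic.pencilFiberToProjectiveSpace t) (2 * 2) θ ∈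
          algebraicClasses (fiberOver DworkSextic.pencil t) 2 :=
        range_map_projectiveSpace_le_algebraicClasses (hYsp t) _ 2 ⟨θ, rfl⟩
      have hθH := isOfHodgeType_of_mem_algebraicClasses_of_isSmoothProjective (hYsp t) 2 hθalg
      have h0 := eq_zero_of_isOfHodgeType_of_isInHodgeFiltration (hYsp t) (by norm_num) (by norm_num)
        (hxH.sub (hYsp t) hθH) hθ
      rw [sub_eq_zero] at h0
      rw [h0]
      exact hθalg
  have hBadc : Bad.Countable :=
    Set.Countable.mono hBad_sub (Set.Countable.biUnion hT0c fun t0 _ =>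
      Set.Countable.biUnion (hΞc t0) fun ξ _ => countable_setOf_mem_and_not_frequently (L t0 ξ))
  -- the exceptional set of parameters
  refine ⟨{ψ | ∃ hψ : ψ ^ 6 ≠ 1, DworkSextic.pencilPoint hψ ∈ Bad}, ?_, ?_⟩
  · refine Set.Countable.mono (fun ψ hψ => ?_) (Set.Countable.biUnion hBadc fun t _ =>
      (show Set.Subsingleton {ψ : ℂ | ∃ hψ : ψ ^ 6 ≠ 1, DworkSextic.pencilPoint hψ = t} from
        fun ψ ⟨hψ, h1⟩ ψ' ⟨hψ', h2⟩ => DworkSextic.pencilPoint_injective hψ hψ' (h1.trans h2.symm)).countable)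
    obtain ⟨hψ, hmem⟩ := hψ
    exact Set.mem_iUnion₂.mpr ⟨_, hmem, hψ, rfl⟩
  · intro ψ hψS hψ6 F X pt c hrat hhodge hinv
    obtain ⟨e, he⟩ := DworkSextic.exists_fiberIso_pencilPoint hψ6
    have hnot : DworkSextic.pencilPoint hψ6 ∉ Bad := fun h => hψS ⟨hψ6, h⟩
    by_contra hc
    apply hnot
    refine ⟨complexBetti.map e.hom (2 * 2) c, (isRationalClass_map_iff_of_iso e).mpr hrat,
      (isOfHodgeType_map_iff_of_iso e).mpr hhodge, dworkPencil_invariant_of_iso e he hinv, fun halg => ?_⟩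
    exact hc ((mem_algebraicClasses_map_iff_of_iso e).mp halg)

end Summit.HodgeConjecture.HodgeConjecture.Theorems
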